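import Summits.QuantumFields.GaugeBoot.PolynomialOrbitAveraging
import Mathlib.Analysis.Normed.Module.HahnBanach
import HarnessLib

/-!
# Square kernels on a compact group: the smoothing identity `∫ f P_a = φ(T_a f)` (gauge-boot, L1 supplement)

HONEST FRAMING (cell `pub-gaugeboot`, page 1 of every file): the venture produces certified bounds
on lattice expectations at stated coupling, gauge group, dimension and torus size; NOT a mass gap,
NOT a continuum limit, NOT a string tension; NOT Yang–Mills-summit-bearing (barriers
`FixedCouplingUltralocality`, `PerturbativeInvisibility`). Structural; it certifies no number.

## Content (first half of "positivity ⇒ realisability" for the lattice bootstrap)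

`Ω` is a compact group with normalised Haar measure `dz`; `A ≤ C(Ω, ℝ)` a subalgebra in which
every element lies in a finite-dimensional subspace `W ≤ A` stable under the two-sided
translations `x ↦ z⁻¹ x w` (`transAct`, `IsTranslationFinite`; for the lattice `Ω = ι → G` and
`A` = the polynomial observables, `W` = words of bounded length). For a LINEAR functional
`φ : C(Ω, ℝ) →ₗ[ℝ] ℝ` (no continuity assumed) and a "bump" `a ∈ A`:

* `sqKernel a w = a(w⁻¹)²`, `smooth a f = T_a f = ∫ a(w⁻¹)² f(· w) dw` (a `C(Ω, ℝ)`-valued Bochner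
  integral of right translates; `smooth_mem`: it stays in `W ∋ f`);
* `sqDensity φ a z = P_a(z) = φ((a ∘ τ_{z⁻¹})²)` — NON-NEGATIVE as soon as `φ` is square-positive on
  `A` (`sqDensity_nonneg`), continuous (`continuous_sqDensity`);
* ★ `integral_mul_sqDensity` — THE SMOOTHING IDENTITY `∫ f(z) P_a(z) dz = φ(T_a f)`: Haar
  invariance `z = x w` inside the finite-dimensional `W ∋ a²`, where `φ` agrees with a continuous
  functional (`exists_clm_eqOn_of_fg`: automatic continuity + Hahn–Banach); `integral_sqDensity`:
  `∫ P_a = (∫ q_a) φ 1`.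

The sequel `SquarePositiveFunctionals.lean` chooses `a` concentrated at `1` and concludes
`inf f ≤ φ f ≤ sup f` for normalised square-positive `φ`.

References: Berg–Christensen–Ressel, Harmonic Analysis on Semigroups (1984) §4.2/§4.5 (the
abstract archimedean route); P. Anderson, M. Kruczenski, Nucl. Phys. B 921 (2017); V. Kazakov,
Z. Zheng, arXiv:2203.11360; Z. Li, S. Zhou, arXiv:2404.17071 (positivity in the lattice
bootstrap). Folklore harmonic analysis.
-/

noncomputable section

open MeasureTheory Filter Topology
open Literature.MathematicalPhysics.QuantumFieldTheory (haarProbability)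

namespace Summit.QuantumFields.GaugeBoot

/-! ## A linear functional is continuous on every finite-dimensional subspace -/

/-- On a finitely generated subspace `W` of a real normed space every linear functional agrees with
a CONTINUOUS linear functional of the whole space (finite-dimensional automatic continuity +
Hahn–Banach). [folklore] -/
theorem exists_clm_eqOn_of_fg {E : Type*} [NormedAddCommGroup E] [NormedSpace ℝ E]
    (φ : E →ₗ[ℝ] ℝ) {W : Submodule ℝ E} (hW : W.FG) :
    ∃ ψ : E →L[ℝ] ℝ, ∀ w ∈ W, ψ w = φ w := by
  haveI : FiniteDimensional ℝ W := (Submodule.fg_iff_finiteDimensional W).1 hW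
  obtain ⟨g, hg, -⟩ := exists_extension_norm_eq W (LinearMap.toContinuousLinearMap (φ.domRestrict W))
  exact ⟨g, fun w hw => by simpa using hg ⟨w, hw⟩⟩

variable {Ω : Type*} [Group Ω] [TopologicalSpace Ω] [IsTopologicalGroup Ω] [CompactSpace Ω]

/-! ## Two-sided translations -/

/-- **The two-sided translations** of the group on itself: `transAct (z, w) x = z⁻¹ x w` (a
jointly continuous family of self-maps of `Ω` indexed by `Ω × Ω`; `(z, 1)` is the left
translation by `z⁻¹`, `(1, w)` the right translation by `w`). [folklore] -/
def transAct (h : Ω × Ω) (x : Ω) : Ω := h.1⁻¹ * x * h.2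

omit [TopologicalSpace Ω] [IsTopologicalGroup Ω] [CompactSpace Ω] in
/-- `transAct` evaluated. -/
@[simp] theorem transAct_apply (h : Ω × Ω) (x : Ω) : transAct h x = h.1⁻¹ * x * h.2 := rfl

omit [CompactSpace Ω] in
/-- Joint continuity of the two-sided translations. -/
theorem continuous_transAct : Continuous fun p : (Ω × Ω) × Ω => transAct p.1 p.2 := by
  simp only [transAct]
  exact ((continuous_fst.comp continuous_fst).inv.mul continuous_snd).mul
    (continuous_snd.comp continuous_fst)

/-- The two-sided translation `x ↦ z⁻¹ x w` as a continuous self-map (`actCM`). [folklore] -/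
abbrev transCM (h : Ω × Ω) : C(Ω, Ω) := actCM transAct continuous_transAct h

/-- **Translation-finite subalgebra**: every element of `A` lies in a finitely generated subspace
of `A` stable under all two-sided translations (for the polynomial observables of a lattice gauge
theory: the span of the words of bounded length). [shape] A parametric definition of a
proposition — NOT a fact. [folklore] -/
def IsTranslationFinite (A : Subalgebra ℝ C(Ω, ℝ)) : Prop :=
  ∀ a ∈ A, ∃ W : Submodule ℝ C(Ω, ℝ), W.FG ∧ W ≤ Subalgebra.toSubmodule A ∧ a ∈ W ∧
    ∀ h : Ω × Ω, W.map (ContinuousMap.compRightAlgHom ℝ ℝ (transCM h)).toLinearMap ≤ W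

variable {A : Subalgebra ℝ C(Ω, ℝ)}

omit [CompactSpace Ω] in
/-- A translation-finite subalgebra is translation stable. -/
theorem IsTranslationFinite.comp_mem (hA : IsTranslationFinite A) {a : C(Ω, ℝ)} (ha : a ∈ A)
    (h : Ω × Ω) : a.comp (transCM h) ∈ A := by
  obtain ⟨W, -, hWA, haW, hW⟩ := hA a ha
  exact hWA (hW h (Submodule.mem_map_of_mem haW))

/-! ## Bochner integrals of continuous `C(Ω, ℝ)`-valued maps over the compact group -/

omit [Group Ω] [IsTopologicalGroup Ω] in
/-- Continuous maps on the compact group are integrable against any finite measure. -/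
theorem integrable_of_continuous_compact {E : Type*} [NormedAddCommGroup E] [MeasurableSpace Ω]
    [OpensMeasurableSpace Ω] {F : Ω → E} (hF : Continuous F) (μ : Measure Ω) [IsFiniteMeasure μ] :
    Integrable F μ :=
  hF.integrable_of_hasCompactSupport
    (IsCompact.of_isClosed_subset isCompact_univ (isClosed_tsupport _) (Set.subset_univ _))

omit [Group Ω] [IsTopologicalGroup Ω] in
/-- Evaluation commutes with the `C(Ω, ℝ)`-valued Bochner integral. -/
theorem integral_apply_eq [MeasurableSpace Ω] [OpensMeasurableSpace Ω] {F : Ω → C(Ω, ℝ)}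
    (hF : Continuous F) (μ : Measure Ω) [IsFiniteMeasure μ] (x : Ω) :
    (∫ z, F z ∂μ) x = ∫ z, F z x ∂μ := by
  have h := ((ContinuousMap.evalCLM ℝ x).integral_comp_comm
    (integrable_of_continuous_compact hF μ)).symm
  simpa using h

omit [Group Ω] [IsTopologicalGroup Ω] in
/-- `‖f ∘ g‖ ≤ ‖f‖` for the sup norm. -/
theorem norm_comp_le (f : C(Ω, ℝ)) (g : C(Ω, Ω)) : ‖f.comp g‖ ≤ ‖f‖ :=
  (ContinuousMap.norm_le _ (norm_nonneg f)).2 fun x => f.norm_coe_le_norm (g x)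

/-! ## The square kernel `q(w) = a(w⁻¹)²`, the density `P`, and the smoothing operator -/

/-- The smoothing weight `q_a(w) = a(w⁻¹)²` of a bump `a`. [folklore] -/
def sqKernel (a : C(Ω, ℝ)) (w : Ω) : ℝ := a w⁻¹ ^ 2

omit [CompactSpace Ω] in
/-- `sqKernel` is continuous. -/
theorem continuous_sqKernel (a : C(Ω, ℝ)) : Continuous (sqKernel a) :=
  (a.continuous.comp continuous_inv).pow 2

omit [IsTopologicalGroup Ω] [CompactSpace Ω] in
/-- `sqKernel` is non-negative. -/
theorem sqKernel_nonneg (a : C(Ω, ℝ)) (w : Ω) : 0 ≤ sqKernel a w := sq_nonneg _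

/-- **The density** `P_a(z) = φ((a ∘ τ_{z⁻¹})²)`, `τ_{z⁻¹} x = z⁻¹ x`. [folklore] -/
def sqDensity (φ : C(Ω, ℝ) →ₗ[ℝ] ℝ) (a : C(Ω, ℝ)) (z : Ω) : ℝ :=
  φ ((a * a).comp (transCM (z, (1 : Ω))))

omit [CompactSpace Ω] in
/-- **The density is non-negative** for a square-positive `φ` and `a ∈ A` (translation stable). -/
theorem sqDensity_nonneg (hA : IsTranslationFinite A) {φ : C(Ω, ℝ) →ₗ[ℝ] ℝ}
    (hpos : ∀ a ∈ A, 0 ≤ φ (a * a)) {a : C(Ω, ℝ)} (ha : a ∈ A) (z : Ω) : 0 ≤ sqDensity φ a z := by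
  rw [sqDensity, ContinuousMap.mul_comp]
  exact hpos _ (hA.comp_mem ha _)

/-- The integrand of `smooth` is continuous in `w`. -/
theorem continuous_smooth_integrand (a f : C(Ω, ℝ)) :
    Continuous fun w : Ω => sqKernel a w • f.comp (transCM ((1 : Ω), w)) :=
  (continuous_sqKernel a).smul
    ((continuous_comp_actCM continuous_transAct f).comp (continuous_const.prodMk continuous_id))

variable [MeasurableSpace Ω] [BorelSpace Ω] [SecondCountableTopology Ω]

/-- **The smoothing operator** `T_a f = ∫ a(w⁻¹)² · f(· w) dw` (a `C(Ω, ℝ)`-valued Bochner integral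
of right translates). [folklore] -/
def smooth (a f : C(Ω, ℝ)) : C(Ω, ℝ) :=
  ∫ w, sqKernel a w • f.comp (transCM ((1 : Ω), w)) ∂haarProbability Ω

omit [SecondCountableTopology Ω] in
/-- `smooth a f` evaluated: `(T_a f)(x) = ∫ a(w⁻¹)² f(x w) dw`. -/
theorem smooth_apply (a f : C(Ω, ℝ)) (x : Ω) :
    smooth a f x = ∫ w, sqKernel a w * f (x * w) ∂haarProbability Ω := by
  rw [smooth, integral_apply_eq (continuous_smooth_integrand a f)]
  simp

/-- `T_a 1 = (∫ q_a) · 1`. -/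
theorem smooth_one (a : C(Ω, ℝ)) :
    smooth a 1 = (∫ w, sqKernel a w ∂haarProbability Ω) • (1 : C(Ω, ℝ)) := by
  have h : (fun w : Ω => sqKernel a w • (1 : C(Ω, ℝ)).comp (transCM ((1 : Ω), w))) =
      fun w => sqKernel a w • (1 : C(Ω, ℝ)) := by
    funext w
    congr 1
  rw [smooth, h, integral_smul_const]

/-- `T_a f` stays in every closed... more precisely: in the finitely generated translation-stable
subspace `W ∋ f`. -/
theorem smooth_mem {W : Submodule ℝ C(Ω, ℝ)} (hWfg : W.FG)
    (hW : ∀ h : Ω × Ω, W.map (ContinuousMap.compRightAlgHom ℝ ℝ (transCM h)).toLinearMap ≤ W)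
    (a : C(Ω, ℝ)) {f : C(Ω, ℝ)} (hf : f ∈ W) : smooth a f ∈ W := by
  haveI : FiniteDimensional ℝ W := (Submodule.fg_iff_finiteDimensional W).1 hWfg
  refine W.convex.integral_mem W.closed_of_finiteDimensional (ae_of_all _ fun w => ?_)
    (integrable_of_continuous_compact (continuous_smooth_integrand a f) _)
  exact W.smul_mem _ (hW ((1 : Ω), w) (Submodule.mem_map_of_mem hf))

/-- **The smoothing identity.** For `a` with `a * a` in a finitely generated translation-stable
`W` on which `φ` is arbitrary (linear): `∫ f(z) P_a(z) dz = φ(T_a f)` — Haar invariance `z = x w`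
inside the finite-dimensional `W`, where `φ` is continuous. [folklore] -/
theorem integral_mul_sqDensity (φ : C(Ω, ℝ) →ₗ[ℝ] ℝ) {W : Submodule ℝ C(Ω, ℝ)} (hWfg : W.FG)
    (hW : ∀ h : Ω × Ω, W.map (ContinuousMap.compRightAlgHom ℝ ℝ (transCM h)).toLinearMap ≤ W)
    {a : C(Ω, ℝ)} (ha : a * a ∈ W) (f : C(Ω, ℝ)) :
    ∫ z, f z * sqDensity φ a z ∂haarProbability Ω = φ (smooth a f) := by
  obtain ⟨ψ, hψ⟩ := exists_clm_eqOn_of_fg φ hWfg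
  haveI : FiniteDimensional ℝ W := (Submodule.fg_iff_finiteDimensional W).1 hWfg
  -- the `W`-valued integrand `z ↦ f z • (a a) ∘ τ_{z⁻¹}`
  set F : Ω → C(Ω, ℝ) := fun z => f z • (a * a).comp (transCM (z, (1 : Ω))) with hF
  have hFc : Continuous F := f.continuous.smul
    ((continuous_comp_actCM continuous_transAct (a * a)).comp (continuous_id.prodMk continuous_const))
  have hFmem : ∀ z, F z ∈ W := fun z => W.smul_mem _ (hW (z, (1 : Ω)) (Submodule.mem_map_of_mem ha))
  have hEmem : (∫ z, F z ∂haarProbability Ω) ∈ W :=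
    W.convex.integral_mem W.closed_of_finiteDimensional (ae_of_all _ hFmem)
      (integrable_of_continuous_compact hFc _)
  -- `∫ f P = ψ (∫ F)`
  have h1 : ∫ z, f z * sqDensity φ a z ∂haarProbability Ω = ψ (∫ z, F z ∂haarProbability Ω) := by
    rw [← ψ.integral_comp_comm (integrable_of_continuous_compact hFc _)]
    refine integral_congr_ae (ae_of_all _ fun z => ?_)
    have hm : (a * a).comp (transCM (z, (1 : Ω))) ∈ W := hW (z, (1 : Ω)) (Submodule.mem_map_of_mem ha)
    simp only [hF, sqDensity, map_smul, smul_eq_mul]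
    rw [hψ _ hm]
  -- `∫ F = T_a f` (Haar invariance, pointwise)
  have h2 : (∫ z, F z ∂haarProbability Ω) = smooth a f := by
    ext x
    rw [integral_apply_eq hFc, smooth_apply]
    have e : ∀ z, F z x = f z * a (z⁻¹ * x) ^ 2 := fun z => by
      simp [hF, sq]
    simp only [e]
    have h3 := integral_mul_left_eq_self (μ := haarProbability Ω)
      (fun z => f z * a (z⁻¹ * x) ^ 2) x
    rw [← h3]
    refine integral_congr_ae (ae_of_all _ fun w => ?_)
    simp only [sqKernel, mul_inv_rev, inv_mul_cancel_right]
    ring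
  rw [h1, h2, hψ _ (h2 ▸ hEmem)]

omit [MeasurableSpace Ω] [BorelSpace Ω] [SecondCountableTopology Ω] in
/-- The density is continuous (it is a continuous functional of a continuous `W`-valued map). -/
theorem continuous_sqDensity (φ : C(Ω, ℝ) →ₗ[ℝ] ℝ) {W : Submodule ℝ C(Ω, ℝ)} (hWfg : W.FG)
    (hW : ∀ h : Ω × Ω, W.map (ContinuousMap.compRightAlgHom ℝ ℝ (transCM h)).toLinearMap ≤ W)
    {a : C(Ω, ℝ)} (ha : a * a ∈ W) : Continuous (sqDensity φ a) := by
  obtain ⟨ψ, hψ⟩ := exists_clm_eqOn_of_fg φ hWfg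
  have h : sqDensity φ a = fun z => ψ ((a * a).comp (transCM (z, (1 : Ω)))) := by
    funext z
    have hm : (a * a).comp (transCM (z, (1 : Ω))) ∈ W := hW (z, (1 : Ω)) (Submodule.mem_map_of_mem ha)
    rw [sqDensity, hψ _ hm]
  rw [h]
  exact ψ.continuous.comp
    ((continuous_comp_actCM continuous_transAct (a * a)).comp (continuous_id.prodMk continuous_const))

/-- `∫ P_a = (∫ q_a) · φ 1`. -/
theorem integral_sqDensity (φ : C(Ω, ℝ) →ₗ[ℝ] ℝ) {W : Submodule ℝ C(Ω, ℝ)} (hWfg : W.FG)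
    (hW : ∀ h : Ω × Ω, W.map (ContinuousMap.compRightAlgHom ℝ ℝ (transCM h)).toLinearMap ≤ W)
    {a : C(Ω, ℝ)} (ha : a * a ∈ W) :
    ∫ z, sqDensity φ a z ∂haarProbability Ω = (∫ w, sqKernel a w ∂haarProbability Ω) * φ 1 := by
  have h := integral_mul_sqDensity φ hWfg hW ha 1
  simp only [ContinuousMap.one_apply, one_mul] at h
  rw [h, smooth_one, map_smul, smul_eq_mul]

end Summit.QuantumFields.GaugeBoot

end
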